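import Literature.GroupTheory.FiniteAbelian.AlternatingPairing
import Summits.BirchSwinnertonDyer.BirchSwinnertonDyer.Theorems.CMKolyvaginAtInertTwoLagrangianTransversal
import HarnessLib

/-!
# Route `CMKolyvaginAtInertTwo`, crux `CMKolyvaginExactAtInertTwo` (stmt-BirchSwinnertonDyer-24277):
# THE LAYERS OF A SYMPLECTIC MODULE HAVE SQUARE ORDER (T5′, KERNEL-STATUS §13.3)

Seat `bsd-line-cmk2-p1` g14 (cell `bsd-print-cf2`); helper (`--supports stmt-BirchSwinnertonDyer-24277`).
THEOREMS ONLY: no definition, no named fact, no `sorry`; no item is closed; BSD is not proved by this.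
Pure finite-abelian-group algebra on the tree's `FiniteAbelian/AlternatingPairing` (even `p`-rank of a
symplectic module, the quotient pairing on `T / T[n]`).

For a finite abelian group `T` with an alternating nondegenerate `B : T × T → ℚ/ℤ`, a prime `p`
and any `n : ℕ`, the `p`-torsion of `nT` — the "layer" `F = nT ∩ T[p]` of the filtered symplectic
module (`n = p^j`) — has order an EVEN power of `p`:

* `natCard_quot_torsionBy_eq` — `#(T / T[n])[p] = #(T[p] ∩ nT)` (`ā ↦ n a`; the tree's
  `natCard_torsionBy_quot_eq` is the case `p = n`);
* `exists_natCard_layer_eq_pow_two_mul` — `∃ m, #(nT ∩ T[p]) = p^{2m}` (the quotient pairing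
  `B(na, b)` on `T / T[n]` is alternating and nondegenerate — `exists_quotTorsionPairing` — so
  `T / T[n]` has even `p`-rank — `exists_natCard_torsionBy_eq_pow_two_mul_of_circle`).

This supplies the integer "half-dimensions" `m_j` of the layers `F_j = p^jT ∩ T[p]` that the
two-sided (IND) reduction (sequel `…LiftGroupsTwoSidedAtTwo`) hands to the threading lemma.

References: [Wall1963QuadraticFormsFiniteGroups] Lemma 7; [TignolAmitsur1986SymplecticModules] §2.
-/

-- single-conjunct summit: `Summit.BirchSwinnertonDyer.BirchSwinnertonDyer.…` repeats the name by design
set_option linter.dupNamespace false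
set_option autoImplicit false

noncomputable section

open AddSubgroup Literature.GroupTheory.FiniteAbelian

namespace Summit.BirchSwinnertonDyer.BirchSwinnertonDyer.Theorems.KolyvaginLiftGroupsTwo

universe u

section LayerSquare

variable {T : Type u} [AddCommGroup T]

/-- **`#(T / T[n])[p] = #(T[p] ∩ nT)`**: multiplication by `n` descends to an injection
`T / T[n] → T` which maps the `p`-torsion of the quotient onto `T[p] ∩ nT`. [folklore] -/
theorem natCard_quot_torsionBy_eq (n p : ℕ) :
    Nat.card (T ⧸ T[(n : ℤ)])[(p : ℤ)] =
      Nat.card ↥(T[(p : ℤ)] ⊓ (nsmulAddMonoidHom (α := T) n).range) := by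
  let ψ : T ⧸ T[(n : ℤ)] →+ T := QuotientAddGroup.lift (T[(n : ℤ)]) (nsmulAddMonoidHom n) (by
    intro a ha
    rwa [AddMonoidHom.mem_ker, nsmulAddMonoidHom_apply, ← AddSubgroup.torsionBy.nsmul_iff])
  have hψ : ∀ a : T, ψ (QuotientAddGroup.mk a) = n • a := fun _ ↦ rfl
  have hinj : Function.Injective ψ := by
    rw [injective_iff_map_eq_zero]
    intro z hz
    induction z using QuotientAddGroup.induction_on with
    | H a =>
      rw [QuotientAddGroup.eq_zero_iff, AddSubgroup.torsionBy.nsmul_iff]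
      exact hz
  refine Nat.card_congr (Equiv.ofBijective
    (fun z ↦ ⟨ψ (z : T ⧸ T[(n : ℤ)]), AddSubgroup.mem_inf.mpr ⟨?_, ?_⟩⟩) ⟨?_, ?_⟩)
  · -- `p • (n a) = 0`
    rw [AddSubgroup.torsionBy.nsmul_iff, ← map_nsmul, AddSubgroup.torsionBy.nsmul_iff.mp z.2,
      map_zero]
  · obtain ⟨a, ha⟩ := QuotientAddGroup.mk_surjective (z : T ⧸ T[(n : ℤ)])
    exact ⟨a, by rw [← ha]; rfl⟩
  · intro z w hzw
    exact Subtype.ext (hinj (congrArg Subtype.val hzw))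
  · rintro ⟨x, hxN, t, rfl⟩
    refine ⟨⟨QuotientAddGroup.mk t, ?_⟩, rfl⟩
    rw [AddSubgroup.torsionBy.nsmul_iff, ← QuotientAddGroup.mk_nsmul, QuotientAddGroup.eq_zero_iff,
      AddSubgroup.torsionBy.nsmul_iff, smul_comm]
    have := AddSubgroup.torsionBy.nsmul_iff.mp hxN
    rwa [nsmulAddMonoidHom_apply] at this

/-- **The layers of a symplectic module have square order**: for `B : T × T → ℚ/ℤ` alternating
and nondegenerate on the finite abelian group `T`, a prime `p` and any `n`, the `p`-torsion of
`nT` has order `p^{2m}` for some `m` (apply the even-`p`-rank theorem to `T / T[n]` with the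
quotient pairing `B(na, b)`). [folklore] -/
theorem exists_natCard_layer_eq_pow_two_mul [Finite T] (B : T →+ T →+ AddCircle (1 : ℚ))
    (halt : ∀ x, B x x = 0) (hnd : ∀ x, (∀ y, B x y = 0) → x = 0) {p : ℕ} (hp : p.Prime) (n : ℕ) :
    ∃ m : ℕ, Nat.card ↥((nsmulAddMonoidHom (α := T) n).range ⊓ (nsmulAddMonoidHom (α := T) p).ker) =
      p ^ (2 * m) := by
  haveI : Fact p.Prime := ⟨hp⟩
  obtain ⟨B', halt', hnd'⟩ := exists_quotTorsionPairing n B halt hnd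
  haveI : Finite (T ⧸ T[(n : ℤ)]) := Finite.of_surjective _ QuotientAddGroup.mk_surjective
  obtain ⟨m, hm⟩ := exists_natCard_torsionBy_eq_pow_two_mul_of_circle p (T ⧸ T[(n : ℤ)]) B' halt' hnd'
  refine ⟨m, ?_⟩
  rw [inf_comm, ker_nsmulAddMonoidHom_eq, ← natCard_quot_torsionBy_eq n p, hm]

end LayerSquare

end Summit.BirchSwinnertonDyer.BirchSwinnertonDyer.Theorems.KolyvaginLiftGroupsTwo

end
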